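import Summits.ValiantsHypothesis.ValiantsHypothesis.Theorems.GeneratorObstructionsPerGenDegreeSuperQPRectangularAtom
import Summits.ValiantsHypothesis.ValiantsHypothesis.Theorems.GeneratorObstructionsPerGenDegreeSuperQPAtomGen

/-!
# Route GeneratorObstructions — K1 `PerGenDegreeSuperQP` (stmt-ValiantsHypothesis-11654),
# line `per-side-atoms`: ATOMS GENERATE the occurrence monoid; K1 for `c ≤ 1`; the
# generation-degree reading of `stub_atomLate`

Third support file of the line (companions: `…AtomCertificates.lean`, `…RectangularAtom.lean`).

1. The occurrence monoid `S(f) = {χ : HWV_χ(ℂ[Δ_n[f]]) ≠ ⊥}` of ANY polynomial `f` (linearly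
   ordered finite variable type, over `ℂ`) is an additive monoid (`occurs_add`: highest-weight
   vectors multiply, `ℂ[Δ_n[f]]` is a domain — BIP 2019 Lemma 2.2) whose nonzero elements have
   negative size, and it is GENERATED BY ITS ATOMS (`exists_multiset_atoms_sum_eq`, strong induction
   on the degree).
2. `exists_late_atom_iff_not_generated` — **late atoms ⟺ late generation**: for `n ≠ 0` and a
   threshold `q`, `S(f)` has an occurring atom of degree `> q` iff `S(f)` is not generated (as an
   additive submonoid of the weight lattice) by its elements of degree `≤ q`. Read for the
   permanent (`per_exists_late_atom_iff_not_generated`), the degree clause of `stub_atomLate` at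
   `(c, m)` says exactly: the occurrence monoid of `ℂ[Δ_m[per_m]]` is NOT generated in degree
   `≤ 2^((log₂ m + c)^c)` — a generation-degree statement about the occurrence SEMIGROUP (not the
   covariant algebra), which is the honest open content for `c ≥ 2`.
3. `perGenDegreeSuperQP_of_le_one` — **K1 in the polynomial regime**: the route decl
   `PerGenDegreeSuperQP` VERBATIM under the extra hypothesis `c ≤ 1`, by the line's own composition
   (`stub_atomLate_of_le_one` of the companion file fed to the landed `stub_atomGen`).

Honest framing: `stub_atomLate`, K1 (`c ≥ 2`) and `GenFlipThesis` remain OPEN; nothing here bears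
on VP versus VNP. References: [BurgisserIkenmeyerPanovaJAMS2019] Lemma 2.2 (semigroup property);
[BurgisserIkenmeyer2017] §3.3 (the degree-`≥ m²` invariant behind the `c ≤ 1` instances).
-/

set_option linter.dupNamespace false

noncomputable section

namespace Summit.ValiantsHypothesis.ValiantsHypothesis.Theorems.GeneratorObstructions.PerGenDegreeSuperQP

open MvPolynomial
open Literature.NumberTheory.DiophantineGeometry Literature.Computability.AlgebraicComplexity
  Literature.Computability.Complexity

/-! ### 1. The occurrence monoid: sums of occurring weights occur -/

section Monoid

variable {σ : Type*} [Fintype σ] [LinearOrder σ]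

/-- **Semigroup property (occurrence form).** If `χ` and `ψ` occur in `ℂ[Δ_n[f]]` then so does
`χ + ψ`: highest-weight vectors multiply (`mul_mem_highestWeightSpace_orbitCoordRep`) and the
coordinate ring of an orbit closure is a domain (`isDomain_orbitCoordRing`).
[cite: BurgisserIkenmeyerPanovaJAMS2019, Lemma 2.2] -/
theorem occurs_add (f : MvPolynomial σ ℂ) (n : ℕ) {χ ψ : Weight σ}
    (hχ : highestWeightSpace (orbitCoordRep f n) χ ≠ ⊥)
    (hψ : highestWeightSpace (orbitCoordRep f n) ψ ≠ ⊥) :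
    highestWeightSpace (orbitCoordRep f n) (χ + ψ) ≠ ⊥ := by
  haveI : Infinite ℂ := CharZero.infinite ℂ
  haveI : IsDomain (OrbitCoordRing f n) := isDomain_orbitCoordRing f n
  obtain ⟨x, hx, hx0⟩ := (Submodule.ne_bot_iff _).mp hχ
  obtain ⟨y, hy, hy0⟩ := (Submodule.ne_bot_iff _).mp hψ
  exact (Submodule.ne_bot_iff _).mpr
    ⟨x * y, mul_mem_highestWeightSpace_orbitCoordRep f n hx hy, mul_ne_zero hx0 hy0⟩

/-- A sum of a NONZERO occurring weight and an occurring weight is nonzero (occurring weights are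
`≤ 0` entrywise). [folklore] -/
theorem add_ne_zero_of_occurs (f : MvPolynomial σ ℂ) (n : ℕ) {χ ψ : Weight σ}
    (hχ : highestWeightSpace (orbitCoordRep f n) χ ≠ ⊥) (hχ0 : χ ≠ 0)
    (hψ : highestWeightSpace (orbitCoordRep f n) ψ ≠ ⊥) : χ + ψ ≠ 0 := by
  haveI : Infinite ℂ := CharZero.infinite ℂ
  obtain ⟨hle1, -⟩ := nonpos_and_exists_size_eq_of_hasHighestWeight_orbitCoordRep f
    (show HasHighestWeight (orbitCoordRep f n) χ from hχ)
  obtain ⟨hle2, -⟩ := nonpos_and_exists_size_eq_of_hasHighestWeight_orbitCoordRep f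
    (show HasHighestWeight (orbitCoordRep f n) ψ from hψ)
  obtain ⟨i, hi⟩ : ∃ i, χ i ≠ 0 := by
    by_contra h
    push Not at h
    exact hχ0 (funext h)
  intro hsum
  have h := congrFun hsum i
  simp only [Pi.add_apply, Pi.zero_apply] at h
  have := hle1 i
  have := hle2 i
  omega

/-- **Nonempty sums of nonzero occurring weights occur and are nonzero.** [cite: BurgisserIkenmeyerPanovaJAMS2019, Lemma 2.2] -/
theorem occurs_multiset_sum (f : MvPolynomial σ ℂ) (n : ℕ) (l : Multiset (Weight σ))
    (hl : ∀ b ∈ l, highestWeightSpace (orbitCoordRep f n) b ≠ ⊥ ∧ b ≠ 0) (hl0 : l ≠ 0) :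
    highestWeightSpace (orbitCoordRep f n) l.sum ≠ ⊥ ∧ l.sum ≠ 0 := by
  induction l using Multiset.induction_on with
  | empty => exact absurd rfl hl0
  | cons a s ih =>
    have ha := hl a (Multiset.mem_cons_self a s)
    rw [Multiset.sum_cons]
    by_cases hs : s = 0
    · subst hs
      simpa using ha
    · have hs' := ih (fun b hb => hl b (Multiset.mem_cons_of_mem hb)) hs
      exact ⟨occurs_add f n ha.1 hs'.1, add_ne_zero_of_occurs f n ha.1 ha.2 hs'.1⟩

/-- **Atoms generate the occurrence monoid.** Every weight occurring in `ℂ[Δ_n[f]]` (`n ≠ 0`) is a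
finite sum of NONZERO occurring ATOMS (weights with no splitting into two nonzero occurring
weights) — strong induction on the degree `-|χ|/n`. [folklore] -/
theorem exists_multiset_atoms_sum_eq (f : MvPolynomial σ ℂ) {n : ℕ} (hn : n ≠ 0) {χ : Weight σ}
    (hχ : highestWeightSpace (orbitCoordRep f n) χ ≠ ⊥) :
    ∃ l : Multiset (Weight σ),
      (∀ a ∈ l, highestWeightSpace (orbitCoordRep f n) a ≠ ⊥ ∧ a ≠ 0 ∧
        ∀ χ₁ χ₂ : Weight σ, χ₁ + χ₂ = a → χ₁ ≠ 0 → χ₂ ≠ 0 →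
          highestWeightSpace (orbitCoordRep f n) χ₁ = ⊥ ∨
            highestWeightSpace (orbitCoordRep f n) χ₂ = ⊥) ∧
      l.sum = χ := by
  classical
  haveI : Infinite ℂ := CharZero.infinite ℂ
  -- strong induction on the degree
  suffices H : ∀ D : ℕ, ∀ χ : Weight σ, highestWeightSpace (orbitCoordRep f n) χ ≠ ⊥ →
      χ.size = -((n * D : ℕ) : ℤ) →
      ∃ l : Multiset (Weight σ),
        (∀ a ∈ l, highestWeightSpace (orbitCoordRep f n) a ≠ ⊥ ∧ a ≠ 0 ∧
          ∀ χ₁ χ₂ : Weight σ, χ₁ + χ₂ = a → χ₁ ≠ 0 → χ₂ ≠ 0 →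
            highestWeightSpace (orbitCoordRep f n) χ₁ = ⊥ ∨
              highestWeightSpace (orbitCoordRep f n) χ₂ = ⊥) ∧
        l.sum = χ by
    obtain ⟨-, D, hD⟩ := nonpos_and_exists_size_eq_of_hasHighestWeight_orbitCoordRep f
      (show HasHighestWeight (orbitCoordRep f n) χ from hχ)
    exact H D χ hχ hD
  intro D
  induction D using Nat.strong_induction_on with
  | _ D ih =>
    intro χ hχ hD
    by_cases h0 : χ = 0
    · exact ⟨0, fun a ha => absurd ha (Multiset.notMem_zero a), by rw [Multiset.sum_zero, h0]⟩
    by_cases hatom : ∀ χ₁ χ₂ : Weight σ, χ₁ + χ₂ = χ → χ₁ ≠ 0 → χ₂ ≠ 0 →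
        highestWeightSpace (orbitCoordRep f n) χ₁ = ⊥ ∨ highestWeightSpace (orbitCoordRep f n) χ₂ = ⊥
    · exact ⟨{χ}, fun a ha => by
        rw [Multiset.mem_singleton] at ha
        subst ha
        exact ⟨hχ, h0, hatom⟩, Multiset.sum_singleton χ⟩
    · push Not at hatom
      obtain ⟨χ₁, χ₂, hsum, h1, h2, hne1, hne2⟩ := hatom
      obtain ⟨hle1, D₁, hD1⟩ := nonpos_and_exists_size_eq_of_hasHighestWeight_orbitCoordRep f
        (show HasHighestWeight (orbitCoordRep f n) χ₁ from hne1)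
      obtain ⟨hle2, D₂, hD2⟩ := nonpos_and_exists_size_eq_of_hasHighestWeight_orbitCoordRep f
        (show HasHighestWeight (orbitCoordRep f n) χ₂ from hne2)
      have hD1pos : D₁ ≠ 0 := by
        rintro rfl
        exact h1 (weight_eq_zero_of_nonpos_of_size_eq_zero hle1 (by simpa using hD1))
      have hD2pos : D₂ ≠ 0 := by
        rintro rfl
        exact h2 (weight_eq_zero_of_nonpos_of_size_eq_zero hle2 (by simpa using hD2))
      have hsize : χ.size = χ₁.size + χ₂.size := by
        rw [← hsum]
        simp only [Weight.size, Pi.add_apply, Finset.sum_add_distrib]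
      have hDD : n * D = n * D₁ + n * D₂ := by
        have : ((n * D : ℕ) : ℤ) = ((n * D₁ : ℕ) : ℤ) + ((n * D₂ : ℕ) : ℤ) := by
          have := hsize; rw [hD, hD1, hD2] at this; linarith
        exact_mod_cast this
      have hD' : D = D₁ + D₂ := by
        have : n * D = n * (D₁ + D₂) := by rw [hDD, mul_add]
        exact Nat.eq_of_mul_eq_mul_left (Nat.pos_of_ne_zero hn) this
      obtain ⟨l₁, hl₁, hs₁⟩ := ih D₁ (by omega) χ₁ hne1 hD1
      obtain ⟨l₂, hl₂, hs₂⟩ := ih D₂ (by omega) χ₂ hne2 hD2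
      refine ⟨l₁ + l₂, fun a ha => ?_, by rw [Multiset.sum_add, hs₁, hs₂, hsum]⟩
      rcases Multiset.mem_add.mp ha with ha | ha
      · exact hl₁ a ha
      · exact hl₂ a ha

/-- **Late atoms ⟺ late generation.** For a form-degree `n ≠ 0` and a threshold `q`, the
occurrence monoid of `ℂ[Δ_n[f]]` has an occurring ATOM of degree `> q` (`n · q < -|χ|`) if and only
if it is NOT generated by its elements of degree `≤ q`: some occurring weight lies outside the
additive submonoid generated by the occurring weights `ψ` with `-|ψ| ≤ n · q`. (`→`: an atom of
degree `> q` is neither of degree `≤ q` nor a sum of two or more nonzero occurring weights, by the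
semigroup property; `←`: atoms generate.) This restates the degree clause of `stub_atomLate` as a
GENERATION-DEGREE statement about the occurrence monoid `S(per_m)`. [folklore] -/
theorem exists_late_atom_iff_not_generated (f : MvPolynomial σ ℂ) {n : ℕ} (hn : n ≠ 0) (q : ℕ) :
    (∃ χ : Weight σ, highestWeightSpace (orbitCoordRep f n) χ ≠ ⊥ ∧
      (∀ χ₁ χ₂ : Weight σ, χ₁ + χ₂ = χ → χ₁ ≠ 0 → χ₂ ≠ 0 →
        highestWeightSpace (orbitCoordRep f n) χ₁ = ⊥ ∨
          highestWeightSpace (orbitCoordRep f n) χ₂ = ⊥) ∧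
      (n : ℤ) * q < -χ.size) ↔
    (∃ χ : Weight σ, highestWeightSpace (orbitCoordRep f n) χ ≠ ⊥ ∧
      χ ∉ AddSubmonoid.closure {ψ : Weight σ |
        highestWeightSpace (orbitCoordRep f n) ψ ≠ ⊥ ∧ -ψ.size ≤ (n : ℤ) * q}) := by
  classical
  haveI : Infinite ℂ := CharZero.infinite ℂ
  constructor
  · rintro ⟨χ, hχ, hatom, hdeg⟩
    refine ⟨χ, hχ, fun hmem => ?_⟩
    obtain ⟨l, hl, hls⟩ := AddSubmonoid.exists_multiset_of_mem_closure hmem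
    -- remove the zero summands
    set l' := l.filter (fun b => b ≠ 0) with hl'
    have hl's : l'.sum = χ := by
      rw [← hls, hl']
      conv_rhs => rw [← Multiset.filter_add_not (fun b : Weight σ => b ≠ 0) l]
      rw [Multiset.sum_add]
      have hz : (l.filter fun b : Weight σ => ¬ b ≠ 0).sum = 0 :=
        Multiset.sum_eq_zero fun b hb => by
          have := (Multiset.mem_filter.mp hb).2
          push Not at this
          exact this
      rw [hz, add_zero]
    have hl'mem : ∀ b ∈ l', (highestWeightSpace (orbitCoordRep f n) b ≠ ⊥ ∧
        -b.size ≤ (n : ℤ) * q) ∧ b ≠ 0 := fun b hb => by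
      obtain ⟨hb1, hb2⟩ := Multiset.mem_filter.mp hb
      exact ⟨hl b hb1, hb2⟩
    -- `χ ≠ 0` (its degree is positive)
    have hχ0 : χ ≠ 0 := by
      rintro rfl
      simp [Weight.size] at hdeg
      have : (0 : ℤ) ≤ (n : ℤ) * q := by positivity
      linarith
    -- case analysis on the number of nonzero summands
    rcases Multiset.empty_or_exists_mem l' with hempty | ⟨a, ha⟩
    · rw [hempty, Multiset.sum_zero] at hl's
      exact hχ0 hl's.symm
    · obtain ⟨s, hs⟩ := Multiset.exists_cons_of_mem ha
      by_cases hs0 : s = 0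
      · -- a single summand: `χ = a` has degree `≤ q`
        rw [hs, hs0, Multiset.cons_zero, Multiset.sum_singleton] at hl's
        have := (hl'mem a ha).1.2
        rw [hl's] at this
        linarith
      · -- at least two summands: `χ = a + (rest)` with both occurring and nonzero
        have hrest := occurs_multiset_sum f n s
          (fun b hb => ⟨(hl'mem b (by rw [hs]; exact Multiset.mem_cons_of_mem hb)).1.1,
            (hl'mem b (by rw [hs]; exact Multiset.mem_cons_of_mem hb)).2⟩) hs0
        rw [hs, Multiset.sum_cons] at hl's
        rcases hatom a s.sum hl's (hl'mem a ha).2 hrest.2 with h | h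
        · exact (hl'mem a ha).1.1 h
        · exact hrest.1 h
  · rintro ⟨χ, hχ, hnot⟩
    obtain ⟨l, hl, hls⟩ := exists_multiset_atoms_sum_eq f hn hχ
    -- some atom in `l` has degree `> q`, else `χ` would be generated
    by_contra hno
    push Not at hno
    apply hnot
    rw [← hls]
    refine AddSubmonoid.multiset_sum_mem _ l fun a ha => AddSubmonoid.subset_closure ?_
    obtain ⟨ha1, -, ha3⟩ := hl a ha
    exact ⟨ha1, hno a ha1 ha3⟩

end Monoid

/-! ### 2. The permanent: K1 in the polynomial regime, and the generation-degree reading -/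

section Permanent

variable {m : ℕ}

/-- **K1 (`PerGenDegreeSuperQP`) holds for `c ≤ 1`.** For `c ∈ {0,1}` and every `m₀` there are
`m ≥ m₀` and a weight `χ` with nonzero generator count `γ_χ(per_m) ≠ 0` and
`m · 2^((log₂ m + c)^c) < -|χ|`: the late atom of `stub_atomLate_of_le_one` fed to the landed
`stub_atomGen` (atoms are generator types), exactly as in the line's composition
`PerGenDegreeSuperQP_of`. The super-quasi-polynomial regime `c ≥ 2` of K1 remains OPEN.
[cite: BurgisserIkenmeyer2017, §3.3] -/
theorem perGenDegreeSuperQP_of_le_one :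
    ∀ c m₀ : ℕ, c ≤ 1 → ∃ m : ℕ, m₀ ≤ m ∧ ∃ χ : Weight (MatIdx m),
      Module.finrank ℂ (↥(highestWeightSpace (orbitCoordRep (MvPolynomial.rename toLex (perPoly (Fin m) ℂ)) m) χ) ⧸ Submodule.comap (highestWeightSpace (orbitCoordRep (MvPolynomial.rename toLex (perPoly (Fin m) ℂ)) m) χ).subtype (⨆ p : Weight (MatIdx m) × Weight (MatIdx m), ⨆ (_ : p.1 + p.2 = χ ∧ p.1 ≠ 0 ∧ p.2 ≠ 0), highestWeightSpace (orbitCoordRep (MvPolynomial.rename toLex (perPoly (Fin m) ℂ)) m) p.1 * highestWeightSpace (orbitCoordRep (MvPolynomial.rename toLex (perPoly (Fin m) ℂ)) m) p.2)) ≠ 0 ∧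
      (m : ℤ) * 2 ^ ((Nat.log 2 m + c) ^ c) < -(Weight.size χ) := by
  intro c m₀ hc
  obtain ⟨m, hm, h1m, χ, hocc, hatom, hdeg⟩ := stub_atomLate_of_le_one c m₀ hc
  exact ⟨m, hm, χ, stub_atomGen m h1m χ hocc hatom, hdeg⟩

/-- **`stub_atomLate` at `(c, m)` as a generation-degree statement**: `ℂ[Δ_m[per_m]]` has an
occurring atom of degree `> 2^((log₂ m + c)^c)` iff its occurrence monoid is not generated in
degree `≤ 2^((log₂ m + c)^c)` (`exists_late_atom_iff_not_generated` read for the permanent).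
[folklore] -/
theorem per_exists_late_atom_iff_not_generated (hm : 1 ≤ m) (c : ℕ) :
    (∃ χ : Weight (MatIdx m),
      highestWeightSpace (orbitCoordRep (MvPolynomial.rename toLex (perPoly (Fin m) ℂ)) m) χ ≠ ⊥ ∧
      (∀ χ₁ χ₂ : Weight (MatIdx m), χ₁ + χ₂ = χ → χ₁ ≠ 0 → χ₂ ≠ 0 →
          highestWeightSpace (orbitCoordRep (MvPolynomial.rename toLex (perPoly (Fin m) ℂ)) m) χ₁ = ⊥ ∨
            highestWeightSpace (orbitCoordRep (MvPolynomial.rename toLex (perPoly (Fin m) ℂ)) m) χ₂ = ⊥) ∧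
      (m : ℤ) * 2 ^ ((Nat.log 2 m + c) ^ c) < -(Weight.size χ)) ↔
    (∃ χ : Weight (MatIdx m),
      highestWeightSpace (orbitCoordRep (MvPolynomial.rename toLex (perPoly (Fin m) ℂ)) m) χ ≠ ⊥ ∧
      χ ∉ AddSubmonoid.closure {ψ : Weight (MatIdx m) |
        highestWeightSpace (orbitCoordRep (MvPolynomial.rename toLex (perPoly (Fin m) ℂ)) m) ψ ≠ ⊥ ∧
        -ψ.size ≤ (m : ℤ) * 2 ^ ((Nat.log 2 m + c) ^ c)}) := by
  have h := exists_late_atom_iff_not_generated (rename toLex (perPoly (Fin m) ℂ)) (n := m)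
    (by omega) (2 ^ ((Nat.log 2 m + c) ^ c))
  push_cast at h
  exact h

end Permanent

end Summit.ValiantsHypothesis.ValiantsHypothesis.Theorems.GeneratorObstructions.PerGenDegreeSuperQP

end
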